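import Summits.Ventures.HSemireg.Mod4CarrierRZ
import Summits.Ventures.HSemireg.Mod4CarrierUpperDegrees

/-!
# Venture HSemireg — MOD-4 line: THEOREM R_Z on the carrier — the upper side degrees, and the Weil FOURFOLD row `(1, 8, 24 ∣ 22 ∣ 23, 8, 1)`
# for the tree's `ContractionSpan.span`

HONEST FRAMING. Part of the Lean index of the computation cell `pub-hsemireg` (widening group W3, seat w3-mod4-1 gen 6; file of
record `HOME/widen/W3/MOD4-OFFSPLIT-w3mod4.md` §10.2 (C1) / §12).  Finite-dimensional exterior algebra over a field ONLY (p4's carrier):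
no abelian variety, no sheaf, no Ext group, no semiregularity map; nothing here says that HC, HC_CM or HC_AV holds; no Literature fact is
declared or used.  WHAT IS PROVED (proof-only): (0) THEOREM R_Z's UPPER side degrees on the carrier (`finrank_S_carrier_nn_deg_dual`:
`dim S_k(c·Θⁿ/n! + a·w₊ + b·w₋) + 2(k′+1)·C(n,k′) = (k′+3)·C(2n,k′)` for `k + k′ = 2n`, `1 ≤ k′ ≤ n − 1`; seat g6's `finrank_S_weil_nn_deg_dual`
with `r_{k′} = k′ + 1`), completing THEOREM R_Z on the carrier in every degree `1 ≤ k ≤ 2n − 1`; (1) THEOREM R_Z's fourfold row (`n = 2`; the BF degree `HT²` is the middle degree), stated for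
the TREE's `ContractionSpan.span ↑L ↑(Ann L) x` literally, for the carrier class `c·Θ²/2 + a·w₊ + b·w₋` (`a, b, c ≠ 0`) on p4's carrier of
Weil type `(2,2)`: `dim span = 24` off `ab ∈ {c², 4c²}` (`finrank_contractionSpan_carrier_fourfold`), and in characteristic `0`: `22` on
`ab = c²`, `23` on `ab = 4c²` (`…_locus_1`, `…_locus_4`) — from seat g6's `finrank_S_carrier_nn_middle` (`Mod4CarrierRZ.lean`) at `n = 2`
with the drop set `#{m ≤ 2 : c²C(2,m)² = ab}` counted.  READING (dictionary not asserted in Lean): `ab = τ = (w,w)_χ/(2D)`, drops at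
`τ/q₂² ∈ {1, 4}` — MOD4-OFFSPLIT's calibration row `(1,8,24−,8,1)` (T1-9s′ (C1)).
All statements and proofs: w3-mod4-1 g6 (2026-08-23).  Namespace `Summit.Ventures.HSemireg.Mod4Carrier`.
References: [BuchweitzFlenner2008HH] Prop. 6.4.4 (why these operators); [BourbakiAlgebre1a3] Ch. III §11 no. 9.
-/

open Module

namespace Summit.Ventures.HSemireg.Mod4Carrier

open Summit.Ventures.HSemireg.WedgeBridge Summit.Ventures.HSemireg.WeilCarrier

variable {K : Type*} [Field K] [DecidableEq K]

/-! ### THEOREM R_Z on the carrier: the upper side degrees (palindromy) -/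

section Upper

variable {n : ℕ} {V : Type*} [AddCommGroup V] [Module K V] (bV : Basis (Fin ((n + n) + (n + n))) K V)

omit [DecidableEq K] in
/-- **THEOREM R_Z ON THE CARRIER, UPPER SIDE DEGREES** (`k + k′ = 2n`, `1 ≤ k′`, `k′ + 1 ≤ n`, `a, b, c ≠ 0`):
`dim S_k(c·Θⁿ/n! + a·w₊ + b·w₋) + 2(k′+1)·C(n,k′) = (k′+3)·C(2n,k′)`. [cite: BuchweitzFlenner2008HH, Prop. 6.4.4] -/
theorem finrank_S_carrier_nn_deg_dual {k k' : ℕ} (hk1 : 1 ≤ k') (hkn : k' + 1 ≤ n) (hkk : k + k' = n + n) {c a b : K}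
    (hc : c ≠ 0) (ha : a ≠ 0) (hb : b ≠ 0) :
    Module.finrank K (S K (Lsp bV) k (Ecl bV (fun i => if i = n then c else 0) (n + n) + a • wUp bV n + b • wLow bV n)) +
        2 * (k' + 1) * n.choose k' = (k' + 3) * (n + n).choose k' := by
  have h := finrank_S_weil_nn_deg_dual bV hk1 hkn hkk (fun i => if i = n then c else 0) ha hb
  rw [hankel1_rank_carrier (by omega) hc] at h
  linarith [h]

end Upper

/-- fourfold carrier drop set, generic: empty. -/
lemma carrier_drop_four_generic {c a b : K} (h1 : a * b ≠ c ^ 2) (h4 : a * b ≠ 4 * c ^ 2) :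
    (Finset.univ.filter fun m : Fin (2 + 1) => c ^ 2 * (Nat.choose 2 (m : ℕ) : K) ^ 2 = a * b).card = 0 := by
  rw [Finset.card_eq_zero, Finset.filter_eq_empty_iff]
  intro m _
  fin_cases m
  all_goals norm_num [Nat.choose]
  all_goals intro e
  all_goals first
    | exact h1 (by linear_combination (-1 : K) * e)
    | exact h4 (by linear_combination (-1 : K) * e)

section CharZero

variable [CharZero K]

/-- fourfold carrier drop set on `ab = c²` (characteristic 0): `{0, 2}`. -/
lemma carrier_drop_four_1 {c a b : K} (hc : c ≠ 0) (hab : a * b = c ^ 2) :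
    (Finset.univ.filter fun m : Fin (2 + 1) => c ^ 2 * (Nat.choose 2 (m : ℕ) : K) ^ 2 = a * b).card = 2 := by
  have h3 := natCast_mul_sq_ne_zero hc (k := 3) (by norm_num)
  push_cast at h3
  have hP : ∀ m : Fin (2 + 1), (c ^ 2 * (Nat.choose 2 (m : ℕ) : K) ^ 2 = a * b) ↔ ((m : ℕ) = 0 ∨ (m : ℕ) = 2) := by
    intro m
    fin_cases m
    all_goals norm_num [Nat.choose, hab]
    exact fun e => h3 (by linear_combination e)
  rw [Finset.filter_congr (fun m _ => hP m)]
  decide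

/-- fourfold carrier drop set on `ab = 4c²` (characteristic 0): `{1}`. -/
lemma carrier_drop_four_4 {c a b : K} (hc : c ≠ 0) (hab : a * b = 4 * c ^ 2) :
    (Finset.univ.filter fun m : Fin (2 + 1) => c ^ 2 * (Nat.choose 2 (m : ℕ) : K) ^ 2 = a * b).card = 1 := by
  have h3 := natCast_mul_sq_ne_zero hc (k := 3) (by norm_num)
  push_cast at h3
  have hP : ∀ m : Fin (2 + 1), (c ^ 2 * (Nat.choose 2 (m : ℕ) : K) ^ 2 = a * b) ↔ ((m : ℕ) = 1) := by
    intro m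
    fin_cases m
    all_goals norm_num [Nat.choose, hab]
    · exact fun e => h3 (by linear_combination -e)
    · ring
    · exact fun e => h3 (by linear_combination -e)
  rw [Finset.filter_congr (fun m _ => hP m)]
  decide

end CharZero

variable {V : Type*} [AddCommGroup V] [Module K V] (bV : Basis (Fin ((2 + 2) + (2 + 2))) K V)

/-- **THE WEIL FOURFOLD CARRIER ROW, degree 2 = middle degree, off the loci** (the TREE's `ContractionSpan.span ↑L ↑(Ann L) x`):
`dim span(c·Θ²/2 + a·w₊ + b·w₋) = 24` when `ab ∉ {c², 4c²}` (`a, b, c ≠ 0`). [cite: BuchweitzFlenner2008HH, Prop. 6.4.4] -/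
theorem finrank_contractionSpan_carrier_fourfold {c a b : K} (hc : c ≠ 0) (ha : a ≠ 0) (hb : b ≠ 0) (h1 : a * b ≠ c ^ 2)
    (h4 : a * b ≠ 4 * c ^ 2) :
    Module.finrank K (Summit.Ventures.HSemireg.ContractionSpan.span (Lsp bV : Set V)
        ((Lsp bV).dualAnnihilator : Set (Module.Dual K V))
        (Ecl bV (fun i => if i = 2 then c else 0) (2 + 2) + a • wUp bV 2 + b • wLow bV 2)) = 24 := by
  have h := finrank_S_carrier_nn_middle bV (n := 2) (by norm_num) hc ha hb
  rw [carrier_drop_four_generic h1 h4, S_two_eq] at h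
  norm_num [Nat.choose] at h
  omega

/-- **THE WEIL FOURFOLD CARRIER ROW on the locus `ab = c²`** (characteristic `0`): `dim span = 22`. [cite: BuchweitzFlenner2008HH, Prop. 6.4.4] -/
theorem finrank_contractionSpan_carrier_fourfold_locus_1 [CharZero K] {c a b : K} (hc : c ≠ 0) (ha : a ≠ 0) (hb : b ≠ 0)
    (hab : a * b = c ^ 2) :
    Module.finrank K (Summit.Ventures.HSemireg.ContractionSpan.span (Lsp bV : Set V)
        ((Lsp bV).dualAnnihilator : Set (Module.Dual K V))
        (Ecl bV (fun i => if i = 2 then c else 0) (2 + 2) + a • wUp bV 2 + b • wLow bV 2)) = 22 := by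
  have h := finrank_S_carrier_nn_middle bV (n := 2) (by norm_num) hc ha hb
  rw [carrier_drop_four_1 hc hab, S_two_eq] at h
  norm_num [Nat.choose] at h
  omega

/-- **THE WEIL FOURFOLD CARRIER ROW on the locus `ab = 4c²`** (characteristic `0`): `dim span = 23`. [cite: BuchweitzFlenner2008HH, Prop. 6.4.4] -/
theorem finrank_contractionSpan_carrier_fourfold_locus_4 [CharZero K] {c a b : K} (hc : c ≠ 0) (ha : a ≠ 0) (hb : b ≠ 0)
    (hab : a * b = 4 * c ^ 2) :
    Module.finrank K (Summit.Ventures.HSemireg.ContractionSpan.span (Lsp bV : Set V)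
        ((Lsp bV).dualAnnihilator : Set (Module.Dual K V))
        (Ecl bV (fun i => if i = 2 then c else 0) (2 + 2) + a • wUp bV 2 + b • wLow bV 2)) = 23 := by
  have h := finrank_S_carrier_nn_middle bV (n := 2) (by norm_num) hc ha hb
  rw [carrier_drop_four_4 hc hab, S_two_eq] at h
  norm_num [Nat.choose] at h
  omega

end Summit.Ventures.HSemireg.Mod4Carrier
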